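import Literature.AlgebraicGeometry.Motives.FaltingsECTateProp1Proofs
import Literature.AlgebraicGeometry.Motives.FaltingsECRankTwoProofs
import Literature.AlgebraicGeometry.Motives.FaltingsECRankTwoLimitProofs
import Literature.AlgebraicGeometry.Motives.FaltingsECIsogenyProofs
import Literature.NumberTheory.EllipticCurves.FrobeniusEquivariantProofs
import Literature.NumberTheory.EllipticCurves.FrobeniusTateModule
import Literature.NumberTheory.EllipticCurves.IsogenyIdProofs
import Literature.NumberTheory.EllipticCurves.TateModuleRank
import Mathlib.RingTheory.Adjoin.Basic
import HarnessLib

/-!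
# Tate's theorem for elliptic curves over a finite field, from quotient isogenies

Sibling file of `Literature.AlgebraicGeometry.Motives.FaltingsEC` (D-0014), assembling the named
fact `Literature.AlgebraicGeometry.Motives.mem_span_range_tateModule_map_of_equivariant_of_finite` — Tate, Invent. Math. 2
(1966), Main Theorem, for elliptic curves `E, E'` over a finite field `k` and a prime `ℓ ≠ char k`
— first in the **`End` case** (`E = E'`) from a single geometric input supplied as a hypothesis,
the existence of quotient isogenies over `k` (`hquot`; Silverman, *AEC*, Prop. III.4.12,
Rem. III.4.13.2, Thm. III.6.1–6.2; vendored as the named fact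
`WeierstrassCurve.exists_isogeny_ker_eq_and_comp_eq_nsmul`), plus, for the integral form,
Cor. III.4.11 over `k` (the tree's named fact
`WeierstrassCurve.Isogeny.exists_eq_comp_nsmul_of_geomTorsion_le_ker W W`); and then in the
**`Hom` case** from one more input, Tate's isogeny theorem (last section):

* `Literature.AlgebraicGeometry.Motives.exists_pow_smul_mem_span_tateModule_map_of_equivariant_end` (**rational form**,
  bijectivity of Tate's map (3) `ℚ_ℓ ⊗ End_k(E) → End_G(V_ℓ E)`): every `ℤ_ℓ`-linear
  `Γ_k`-equivariant `f : T_ℓ E → T_ℓ E` has a multiple `ℓ ^ n • f` in the `ℤ_ℓ`-span `M` of the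
  maps `T_ℓ φ`, `φ` an endomorphism of `E` over `k`;
* `Literature.AlgebraicGeometry.Motives.mem_span_tateModule_map_of_equivariant_end` (**integral form**, bijectivity of (1)):
  `f ∈ M`, given in addition Cor. III.4.11 (Tate's Lemma 1,
  `Literature.AlgebraicGeometry.Motives.FaltingsECTateLemma1Proofs`);
* `Literature.AlgebraicGeometry.Motives.exists_pow_smul_mem_span_tateModule_map_of_equivariant_of_isogeny` (the `Hom` case
  for two isogenous curves, rational form, from `hquot` alone) and
  `…_of_quot_of_isIsogenous` (the named fact for isogenous `E, E'` from `hquot`, `h411`);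
* `Literature.AlgebraicGeometry.Motives.exists_pow_smul_mem_span_tateModule_map_of_equivariant` (the `Hom` case, rational
  form) and the assembled named fact
  `Literature.AlgebraicGeometry.Motives.mem_span_range_tateModule_map_of_equivariant_of_finite_of_quot` (from `hquot`, `h411`
  and the isogeny theorem `hisog`), resp. `…_end_of_quot` (`E = E'`, from `hquot`, `h411` only),
  and the `End` form `Literature.AlgebraicGeometry.Motives.mem_span_range_tateEndRingHom_iff_of_finite_of_quot` (the named
  fact `mem_span_range_tateEndRingHom_iff_of_finite W ℓ` of `FaltingsEC`, from `hquot`, `h411`).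

## The proof (Tate 1966, §§1–2, specialised to `g = 1` and a fixed prime `ℓ`)

Let `π = T_ℓ(π_E)` be the action of the Frobenius `φ_k` on `T = T_ℓ E ≅ ℤ_ℓ²`
(`Literature.NumberTheory.EllipticCurves.FrobeniusEndomorphism`, `FrobeniusTateModule`);
`Γ_k`-equivariance of `f` gives `f π = π f` (Tate, p. 138: `π` topologically generates `G`, `F_ℓ = ℚ_ℓ ⊗ ℚ(π)`).

* If `π` is **not a scalar**, its commutant in `End(ℤ_ℓ²)` is `ℚ_ℓ[π] ∩ End(ℤ_ℓ²)`
  (`Literature.AlgebraicGeometry.Motives.FinTwo.exists_smul_eq_of_commute`): `δ • f = α + β π = α T_ℓ(1) + β T_ℓ(π_E) ∈ M` with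
  `δ ≠ 0`, and `δ = ℓ ^ n ·` unit. (Tate's dimension count: both sides of (3) are
  `ℚ_ℓ ⊗ ℚ(π)`; no geometry is needed.)
* If `π = c` is a **scalar**, every cyclic subgroup of `E[ℓ^n]` is `k`-rational, Tate's
  Proposition 1 applies to every line of `V_ℓ E`
  (`Literature.AlgebraicGeometry.Motives.exists_isogeny_tateModule_map_approx`: the quotients `E/⟨v_n⟩` run through finitely
  many Weierstrass curves over `k`; `Literature.AlgebraicGeometry.Motives.FinTwo.exists_ne_zero_forall_mem_span_of_approx`: the
  compactness argument), so that every line is the image of a non-zero element of `M`; by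
  Proposition 2 with Lemma 4 in the form `Literature.AlgebraicGeometry.Motives.FinTwo.exists_smul_mem_of_forall_exists_range_le`
  (the semisimplicity of `E_ℓ` being replaced by the injectivity of `T_ℓ φ` for isogenies `φ`,
  `Literature.AlgebraicGeometry.Motives.tateModule_map_injective`), `M` has finite index in `End(T_ℓ E)`, i.e. some
  `ℓ ^ n • f ∈ M` for every `f`.

## References

* [Tate1966Endomorphisms] J. Tate, *Endomorphisms of abelian varieties over finite fields*,
  Invent. Math. 2 (1966), 134–144, Main Theorem, §1 Lemmas 1 and 4, §2 Propositions 1–2.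
* [SilvermanAEC2009] J. H. Silverman, *The Arithmetic of Elliptic Curves*, 2nd ed., GTM 106,
  III.4.11–4.13, III.6.1–6.2, III.7.4, III.7.7(a), V.§3.
-/

noncomputable section

open scoped Classical

universe u

namespace Literature.AlgebraicGeometry.Motives

open WeierstrassCurve

variable {K : Type u} [Field K] {W : WeierstrassCurve K} (ℓ : ℕ) [Fact ℓ.Prime]

/-! ## Preliminaries on `T_ℓ E ≅ ℤ_ℓ²` -/

variable (W) in
/-- `T_ℓ E ≅ ℤ_ℓ²` for an elliptic curve and `ℓ ≠ char K` (Silverman, *AEC*, Prop. III.7.1(a);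
the tree's `Literature.NumberTheory.EllipticCurves.TateModule.nonempty_linearEquiv_of_card_torsionBy` with `#E[ℓ^n] = ℓ^{2n}`,
`WeierstrassCurve.card_torsionPoints_eq_sq_holds`). [cite: SilvermanAEC2009, Prop. III.7.1(a)] -/
theorem nonempty_tateModule_linearEquiv [W.IsElliptic] (hℓ : (ℓ : K) ≠ 0) :
    Nonempty (W.tateModule ℓ ≃ₗ[ℤ_[ℓ]] (Fin 2 → ℤ_[ℓ])) :=
  Literature.NumberTheory.EllipticCurves.TateModule.nonempty_linearEquiv_of_card_torsionBy (d := 2)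
    (card_geomTorsion_pow_eq W ℓ (card_torsionPoints_eq_sq_holds W (AlgebraicClosure K)) hℓ)

/-- A non-zero element of a Tate module is `ℓ ^ j` times a primitive one (`v_1 ≠ 0`): divide by
`ℓ` while the first component vanishes (`ker (T_ℓ A → A[ℓ]) = ℓ T_ℓ A`); this stops because some
component of `v` is non-zero. [folklore] -/
theorem exists_eq_pow_smul_of_ne_zero {A : Type u} [AddCommGroup A] {v : Literature.NumberTheory.EllipticCurves.TateModule A ℓ}
    (hv : v ≠ 0) : ∃ (j : ℕ) (v₀ : Literature.NumberTheory.EllipticCurves.TateModule A ℓ), v = (ℓ : ℤ_[ℓ]) ^ j • v₀ ∧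
      Literature.NumberTheory.EllipticCurves.TateModule.proj ℓ 1 v₀ ≠ 0 := by
  obtain ⟨n, hn⟩ : ∃ n, Literature.NumberTheory.EllipticCurves.TateModule.proj ℓ n v ≠ 0 := by
    by_contra! h
    exact hv (Literature.NumberTheory.EllipticCurves.TateModule.ext fun n ↦ by rw [h n, map_zero])
  induction n generalizing v with
  | zero =>
    exfalso
    refine hn ?_
    have := Literature.NumberTheory.EllipticCurves.TateModule.pow_smul_proj 0 v
    rwa [pow_zero, one_smul] at this
  | succ n ih =>
    by_cases h1 : Literature.NumberTheory.EllipticCurves.TateModule.proj ℓ 1 v = 0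
    · obtain ⟨v₁, rfl⟩ := Literature.NumberTheory.EllipticCurves.TateModule.exists_pow_smul_eq_of_proj_eq_zero h1
      have hv₁ : v₁ ≠ 0 := by
        rintro rfl
        exact hv (smul_zero _)
      have hn' : Literature.NumberTheory.EllipticCurves.TateModule.proj ℓ n v₁ ≠ 0 := by
        rwa [pow_one, Literature.NumberTheory.EllipticCurves.TateModule.proj_natCast_smul, Literature.NumberTheory.EllipticCurves.TateModule.smul_proj_succ] at hn
      obtain ⟨j, v₀, rfl, hv₀⟩ := ih hv₁ hn'
      exact ⟨j + 1, v₀, by rw [smul_smul, ← pow_add, add_comm], hv₀⟩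
    · exact ⟨0, v, by rw [pow_zero, one_smul], h1⟩

/-! ## Scalar Frobenius: every cyclic subgroup of `E[ℓ^n]` is `k`-rational -/

/-- If an element `σ ∈ Γ_k` acts on `T_ℓ E` as a scalar `c ∈ ℤ_ℓ`, then so do its powers:
`σ ^ i • x = c ^ i • x`. [folklore] -/
theorem pow_smul_eq_pow_smul_of_smul_eq {σ : Field.absoluteGaloisGroup K} {c : ℤ_[ℓ]}
    (hπ : ∀ x : W.tateModule ℓ, σ • x = c • x) (i : ℕ) (x : W.tateModule ℓ) :
    σ ^ i • x = c ^ i • x := by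
  induction i with
  | zero => rw [pow_zero, pow_zero, one_smul, one_smul]
  | succ i ih => rw [pow_succ', mul_smul, ih, smul_comm, hπ, smul_smul, ← pow_succ]

/-- If the Frobenius `σ_q ∈ Γ_k` acts on `T_ℓ E` as a scalar, then for every `v ∈ T_ℓ E` the
cyclic subgroups `⟨v_n⟩ ⊆ E[ℓ^n]` are `Γ_k`-stable: each `τ ∈ Γ_k` acts on the point `v_n` as a
power of Frobenius (`WeierstrassCurve.exists_smul_eq_frobenius_pow_smul_of_finite`), i.e. as an
integer. (Tate, Invent. Math. 2 (1966), p. 138: Frobenius topologically generates `G`.)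
[folklore] -/
theorem smul_proj_mem_zmultiples [Finite K] {σ : Field.absoluteGaloisGroup K}
    (hσ : ∀ x : AlgebraicClosure K, σ • x = x ^ Nat.card K) {c : ℤ_[ℓ]}
    (hπ : ∀ x : W.tateModule ℓ, σ • x = c • x) (v : W.tateModule ℓ) (n : ℕ)
    (τ : Field.absoluteGaloisGroup K) :
    τ • Literature.NumberTheory.EllipticCurves.TateModule.proj ℓ n v ∈ AddSubgroup.zmultiples (Literature.NumberTheory.EllipticCurves.TateModule.proj ℓ n v) := by
  obtain ⟨i, hi⟩ := exists_smul_eq_frobenius_pow_smul_of_finite W hσ τ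
    (Set.finite_singleton (Literature.NumberTheory.EllipticCurves.TateModule.proj ℓ n v))
  rw [hi _ rfl, ← Literature.NumberTheory.EllipticCurves.TateModule.proj_smul_of_distribMulAction, pow_smul_eq_pow_smul_of_smul_eq ℓ hπ,
    Literature.NumberTheory.EllipticCurves.TateModule.proj_smul]
  exact AddSubgroup.nsmul_mem _ (AddSubgroup.mem_zmultiples _) _

/-! ## The `End` theorem, rational form -/

/-- **Tate's theorem for `End_k(E)`, rational form** (bijectivity of Tate's map (3),
`ℚ_ℓ ⊗ End_k(E) → End_G(V_ℓ E)`, for an elliptic curve). Let `E` be an elliptic curve over a finite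
field `k`, `ℓ` a prime with `ℓ ≠ 0` in `k`, and assume quotient isogenies over `k` exist (`hquot`,
the body of the named fact for Silverman, *AEC*, Prop. III.4.12, Rem. III.4.13.2,
Thm. III.6.1–6.2: for a finite `Γ_k`-stable subgroup `S ⊆ E(k̄)` there are an elliptic curve `E'`
over `k` and isogenies `g : E → E'`, `f : E' → E` over `k` with `ker g = S`, `f ∘ g = [#S]`,
`g ∘ f = [#S]`). Then for every `ℤ_ℓ`-linear `Γ_k`-equivariant `f : T_ℓ E → T_ℓ E` some multiple
`ℓ ^ n • f` lies in the `ℤ_ℓ`-span of the maps `T_ℓ φ`, `φ` an endomorphism of `E` over `k`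
(module docstring for the proof). Tate, Invent. Math. 2 (1966), Main Theorem with §1 Lemma 1 and
§2; Silverman, *AEC*, III.7.7(a). [cite: Tate1966Endomorphisms, Main Theorem] -/
theorem exists_pow_smul_mem_span_tateModule_map_of_equivariant_end [Finite K] [W.IsElliptic]
    (hℓ : (ℓ : K) ≠ 0)
    (hquot : ∀ S : AddSubgroup W.geomPoints, (S : Set W.geomPoints).Finite →
      (∀ (σ : Field.absoluteGaloisGroup K) (P : W.geomPoints), P ∈ S → σ • P ∈ S) →
      ∃ (W' : WeierstrassCurve K) (_ : W'.IsElliptic) (g : Isogeny W W') (f : Isogeny W' W),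
        g.toAddMonoidHom.ker = S ∧ (∀ P, f (g P) = Nat.card S • P) ∧
          ∀ Q, g (f Q) = Nat.card S • Q)
    (f : W.tateModule ℓ →ₗ[ℤ_[ℓ]] W.tateModule ℓ)
    (hf : ∀ (σ : Field.absoluteGaloisGroup K) (x : W.tateModule ℓ), f (σ • x) = σ • f x) :
    ∃ n : ℕ, (ℓ : ℤ_[ℓ]) ^ n • f ∈ Submodule.span ℤ_[ℓ]
      (Set.range fun φ : Isogeny W W ↦ Literature.NumberTheory.EllipticCurves.TateModule.map ℓ φ.toAddMonoidHom) := by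
  set S := Submodule.span ℤ_[ℓ]
    (Set.range fun φ : Isogeny W W ↦ Literature.NumberTheory.EllipticCurves.TateModule.map ℓ φ.toAddMonoidHom) with hS
  -- it suffices to find `d ≠ 0` with `d • f ∈ S`
  suffices key : ∃ d : ℤ_[ℓ], d ≠ 0 ∧ d • f ∈ S by
    obtain ⟨d, hd, hdf⟩ := key
    obtain ⟨n, u, rfl⟩ : ∃ (n : ℕ) (u : ℤ_[ℓ]ˣ), d = u * (ℓ : ℤ_[ℓ]) ^ n :=
      ⟨_, _, PadicInt.unitCoeff_spec hd⟩
    refine ⟨n, ?_⟩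
    have hu : (ℓ : ℤ_[ℓ]) ^ n • f = ((u⁻¹ : ℤ_[ℓ]ˣ) : ℤ_[ℓ]) • (((u : ℤ_[ℓ]) * (ℓ : ℤ_[ℓ]) ^ n) • f) := by
      rw [smul_smul, ← mul_assoc, Units.inv_mul, one_mul]
    rw [hu]
    exact S.smul_mem _ hdf
  obtain ⟨e⟩ := nonempty_tateModule_linearEquiv W ℓ hℓ
  -- the Frobenius `σ_q`, its action `π` on `T_ℓ E` (`= T_ℓ(π_E)`), and the commutation `f π = π f`
  obtain ⟨σ, hσ⟩ := exists_frobenius_absoluteGaloisGroup K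
  set π : Module.End ℤ_[ℓ] (W.tateModule ℓ) := W.galoisRepTate ℓ σ with hπdef
  have hπS : π ∈ S :=
    Submodule.subset_span ⟨W.frobeniusIsogeny hσ, W.tateModule_map_frobeniusIsogeny hσ ℓ⟩
  have h1S : (1 : Module.End ℤ_[ℓ] (W.tateModule ℓ)) ∈ S := by
    refine Submodule.subset_span ⟨Isogeny.id W, ?_⟩
    exact Literature.NumberTheory.EllipticCurves.TateModule.map_id
  have hfπ : f * π = π * f := LinearMap.ext fun x ↦ by
    rw [Module.End.mul_apply, Module.End.mul_apply, hπdef, galoisRepTate_apply_apply,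
      galoisRepTate_apply_apply, hf]
  by_cases hscalar : ∃ c : ℤ_[ℓ], e.conj π = c • 1
  · /- **Scalar Frobenius**: Proposition 1 for every line, then density. -/
    obtain ⟨c, hc⟩ := hscalar
    have hπc : ∀ x : W.tateModule ℓ, σ • x = c • x := fun x ↦ by
      have h1 : π = c • 1 := by
        have := congrArg e.symm.conj hc
        rwa [LinearEquiv.conj_symm_conj, map_smul, Module.End.one_eq_id, LinearEquiv.conj_id]
          at this
      have h2 := LinearMap.congr_fun h1 x
      rw [LinearMap.smul_apply, Module.End.one_apply, hπdef, galoisRepTate_apply_apply] at h2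
      exact h2
    -- the set `𝓡` of conjugated Tate-module maps of the elements of `Hom_k(E, E)`
    set 𝓡 : Set (Module.End ℤ_[ℓ] (Fin 2 → ℤ_[ℓ])) :=
      {u | ∃ g ∈ homModule W W, u = e.conj (Literature.NumberTheory.EllipticCurves.TateModule.map ℓ g)} with h𝓡
    have mem𝓡 : ∀ g ∈ homModule W W, e.conj (Literature.NumberTheory.EllipticCurves.TateModule.map ℓ g) ∈ 𝓡 := fun g hg ↦ ⟨g, hg, rfl⟩
    have hHom : ∀ g ∈ homModule W W, g = 0 ∨ ∃ φ : Isogeny W W, φ.toAddMonoidHom = g :=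
      fun g hg ↦ (mem_homModule_iff_holds W W g).mp hg
    have h𝓡S : ∀ u ∈ 𝓡, u ∈ S.map (e.conj : Module.End ℤ_[ℓ] (W.tateModule ℓ) →ₗ[ℤ_[ℓ]]
        Module.End ℤ_[ℓ] (Fin 2 → ℤ_[ℓ])) := by
      rintro u ⟨g, hg, rfl⟩
      refine Submodule.mem_map_of_mem ?_
      rcases hHom g hg with rfl | ⟨φ, rfl⟩
      · rw [Literature.NumberTheory.EllipticCurves.TateModule.map_zero]
        exact S.zero_mem
      · exact Submodule.subset_span ⟨φ, rfl⟩
    have h𝓡mul : ∀ r ∈ 𝓡, ∀ s ∈ 𝓡, r * s ∈ 𝓡 := by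
      rintro r ⟨g, hg, rfl⟩ s ⟨g', hg', rfl⟩
      have hcomp : g.comp g' ∈ homModule W W := by
        rcases hHom g hg with rfl | ⟨φ, rfl⟩
        · rw [AddMonoidHom.zero_comp]
          exact Submodule.zero_mem _
        rcases hHom g' hg' with rfl | ⟨ψ, rfl⟩
        · rw [AddMonoidHom.comp_zero]
          exact Submodule.zero_mem _
        · exact (φ.comp ψ).toAddMonoidHom_mem_homModule
      refine ⟨g.comp g', hcomp, ?_⟩
      rw [Literature.NumberTheory.EllipticCurves.TateModule.map_comp, LinearEquiv.conj_comp, Module.End.mul_eq_comp]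
    have h𝓡sub : ∀ r ∈ 𝓡, ∀ s ∈ 𝓡, r - s ∈ 𝓡 := by
      rintro r ⟨g, hg, rfl⟩ s ⟨g', hg', rfl⟩
      exact ⟨g - g', Submodule.sub_mem _ hg hg', by rw [Literature.NumberTheory.EllipticCurves.TateModule.map_sub, map_sub]⟩
    have h𝓡inj : ∀ r ∈ 𝓡, ∀ w : Fin 2 → ℤ_[ℓ], w ≠ 0 → r w = 0 → r = 0 := by
      rintro r ⟨g, hg, rfl⟩ w hw hrw
      rcases hHom g hg with rfl | ⟨φ, rfl⟩
      · rw [Literature.NumberTheory.EllipticCurves.TateModule.map_zero, map_zero]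
      · exfalso
        rw [LinearEquiv.conj_apply_apply, e.map_eq_zero_iff] at hrw
        have h0 : e.symm w = 0 :=
          tateModule_map_injective ℓ φ (hrw.trans (map_zero _).symm)
        rw [e.symm.map_eq_zero_iff] at h0
        exact hw h0
    have h1𝓡 : (1 : Module.End ℤ_[ℓ] (Fin 2 → ℤ_[ℓ])) ∈ 𝓡 := by
      refine ⟨(Isogeny.id W).toAddMonoidHom, (Isogeny.id W).toAddMonoidHom_mem_homModule, ?_⟩
      rw [show Literature.NumberTheory.EllipticCurves.TateModule.map ℓ (Isogeny.id W).toAddMonoidHom = LinearMap.id from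
        Literature.NumberTheory.EllipticCurves.TateModule.map_id, LinearEquiv.conj_id]
      rfl
    -- the subalgebra generated by `𝓡` is its span
    set M : Subalgebra ℤ_[ℓ] (Module.End ℤ_[ℓ] (Fin 2 → ℤ_[ℓ])) := Algebra.adjoin ℤ_[ℓ] 𝓡 with hM
    have hMspan : ∀ u ∈ M, u ∈ Submodule.span ℤ_[ℓ] 𝓡 := by
      intro u hu
      have hcl : ((Submonoid.closure 𝓡 : Submonoid (Module.End ℤ_[ℓ] (Fin 2 → ℤ_[ℓ]))) :
          Set (Module.End ℤ_[ℓ] (Fin 2 → ℤ_[ℓ]))) = 𝓡 := by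
        let T𝓡 : Submonoid (Module.End ℤ_[ℓ] (Fin 2 → ℤ_[ℓ])) :=
          { carrier := 𝓡
            mul_mem' := fun {a b} ha hb ↦ h𝓡mul a ha b hb
            one_mem' := h1𝓡 }
        exact congrArg SetLike.coe (Submonoid.closure_eq T𝓡)
      have hspan := Algebra.adjoin_eq_span (R := ℤ_[ℓ]) 𝓡
      rw [hcl] at hspan
      rw [hM, ← Subalgebra.mem_toSubmodule, hspan] at hu
      exact hu
    have h𝓡M : 𝓡 ⊆ M := Algebra.subset_adjoin
    have hℓ0 : (ℓ : ℤ_[ℓ]) ≠ 0 := Nat.cast_ne_zero.mpr (Fact.out : ℓ.Prime).ne_zero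
    -- **Proposition 1** for every line of `ℤ_ℓ²`
    have hP1 : ∀ v' : Fin 2 → ℤ_[ℓ], v' ≠ 0 → ∃ u ∈ M, u ≠ 0 ∧
        ∀ x, u x ∈ (ℤ_[ℓ] ∙ v' : Submodule ℤ_[ℓ] (Fin 2 → ℤ_[ℓ])) := by
      intro v' hv'
      -- the primitive part `v₀` of `v = e⁻¹ v' = ℓ ^ j • v₀`
      have hv : e.symm v' ≠ 0 := by rwa [e.symm.map_ne_zero_iff]
      obtain ⟨j, v₀, hvj, hv₀⟩ := exists_eq_pow_smul_of_ne_zero ℓ hv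
      have hv₀0 : v₀ ≠ 0 := by
        rintro rfl
        exact hv₀ (map_zero _)
      have hv'eq : v' = (ℓ : ℤ_[ℓ]) ^ j • e v₀ := by
        rw [← map_smul, ← hvj, LinearEquiv.apply_symm_apply]
      -- the construction (quotients `E/⟨v₀,n⟩` through finitely many curves)
      obtain ⟨n₀, happrox⟩ := exists_isogeny_tateModule_map_approx ℓ hquot hv₀
        (fun n τ ↦ smul_proj_mem_zmultiples ℓ hσ hπc v₀ n τ)
      -- the compactness argument on `ℤ_ℓ²`
      obtain ⟨u, huN, hu0, hu⟩ := FinTwo.exists_ne_zero_forall_mem_span_of_approx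
        (Submodule.span ℤ_[ℓ] 𝓡) (e v₀) (c := (ℓ : ℤ_[ℓ]) ^ n₀ • e v₀)
        (smul_ne_zero (pow_ne_zero _ hℓ0) (by rwa [e.map_ne_zero_iff])) (fun k ↦ by
          obtain ⟨φ, ⟨x, hx⟩, hφ⟩ := happrox k
          refine ⟨e.conj (Literature.NumberTheory.EllipticCurves.TateModule.map ℓ φ.toAddMonoidHom),
            Submodule.subset_span (mem𝓡 _ φ.toAddMonoidHom_mem_homModule), ⟨e x, ?_⟩,
            fun x' ↦ ?_⟩
          · rw [LinearEquiv.conj_apply_apply, LinearEquiv.symm_apply_apply, hx, map_smul]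
          · obtain ⟨a, z, haz⟩ := hφ (e.symm x')
            exact ⟨a, e z, by rw [LinearEquiv.conj_apply_apply, haz, map_add, map_smul, map_smul]⟩)
      refine ⟨(ℓ : ℤ_[ℓ]) ^ j • u, ?_, smul_ne_zero (pow_ne_zero _ hℓ0) hu0, fun x ↦ ?_⟩
      · exact M.smul_mem (Algebra.span_le_adjoin ℤ_[ℓ] 𝓡 huN) _
      · obtain ⟨a, ha⟩ := Submodule.mem_span_singleton.mp (hu x)
        rw [LinearMap.smul_apply, ← ha, smul_smul, mul_comm, ← smul_smul, hv'eq]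
        exact Submodule.smul_mem _ _ (Submodule.mem_span_singleton_self _)
    -- **Proposition 2 / Lemma 4**: density
    obtain ⟨d, hd, hdM⟩ :=
      FinTwo.exists_smul_mem_of_forall_exists_range_le M 𝓡 hMspan h𝓡M h𝓡mul h𝓡sub h𝓡inj hP1
        (e.conj f)
    refine ⟨d, hd, ?_⟩
    -- pull back along `e.conj`
    have hmem : d • e.conj f ∈ S.map (e.conj : Module.End ℤ_[ℓ] (W.tateModule ℓ) →ₗ[ℤ_[ℓ]]
        Module.End ℤ_[ℓ] (Fin 2 → ℤ_[ℓ])) :=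
      (Submodule.span_le.mpr fun u hu ↦ h𝓡S u hu) (hMspan _ hdM)
    obtain ⟨w, hwS, hw⟩ := hmem
    have hwf : w = d • f := e.conj.injective (by rw [map_smul]; exact hw)
    rwa [hwf] at hwS
  · /- **Non-scalar Frobenius**: the commutant of `π` is `ℚ_ℓ[π]`. -/
    push Not at hscalar
    obtain ⟨z, hD⟩ := FinTwo.exists_det_apply_ne_zero hscalar
    have hcomm : e.conj f * e.conj π = e.conj π * e.conj f := by
      rw [Module.End.mul_eq_comp, Module.End.mul_eq_comp, ← LinearEquiv.conj_comp,
        ← LinearEquiv.conj_comp, ← Module.End.mul_eq_comp, ← Module.End.mul_eq_comp, hfπ]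
    obtain ⟨α, β, hαβ⟩ := FinTwo.exists_smul_eq_of_commute z hD hcomm
    refine ⟨_, hD, ?_⟩
    have : (z 0 * (e.conj π) z 1 - z 1 * (e.conj π) z 0) • f = α • 1 + β • π := by
      apply e.conj.injective
      rw [map_smul, hαβ, map_add, map_smul, map_smul]
      congr 2
      exact (LinearEquiv.conj_id e).symm
    rw [this]
    exact S.add_mem (S.smul_mem _ h1S) (S.smul_mem _ hπS)

/-- **Tate's theorem for `End_k(E)`, integral form** (bijectivity of Tate's map (1) for
`A' = A'' = E` an elliptic curve): under the hypotheses of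
`exists_pow_smul_mem_span_tateModule_map_of_equivariant_end` and Silverman, *AEC*, Cor. III.4.11
over `k` (the named fact `Isogeny.exists_eq_comp_nsmul_of_geomTorsion_le_ker W W`, hypothesis
`h411`, through Tate's Lemma 1 `mem_span_tateModule_map_of_pow_smul_mem`), every `Γ_k`-equivariant
`ℤ_ℓ`-linear endomorphism of `T_ℓ E` lies in the `ℤ_ℓ`-span of the `T_ℓ φ`, `φ ∈ End_k(E)`.
Tate, Invent. Math. 2 (1966), Main Theorem; Silverman, *AEC*, III.7.7(a).
[cite: Tate1966Endomorphisms, Main Theorem] -/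
theorem mem_span_tateModule_map_of_equivariant_end [Finite K] [W.IsElliptic] (hℓ : (ℓ : K) ≠ 0)
    (hquot : ∀ S : AddSubgroup W.geomPoints, (S : Set W.geomPoints).Finite →
      (∀ (σ : Field.absoluteGaloisGroup K) (P : W.geomPoints), P ∈ S → σ • P ∈ S) →
      ∃ (W' : WeierstrassCurve K) (_ : W'.IsElliptic) (g : Isogeny W W') (f : Isogeny W' W),
        g.toAddMonoidHom.ker = S ∧ (∀ P, f (g P) = Nat.card S • P) ∧
          ∀ Q, g (f Q) = Nat.card S • Q)
    (h411 : Isogeny.exists_eq_comp_nsmul_of_geomTorsion_le_ker W W)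
    (f : W.tateModule ℓ →ₗ[ℤ_[ℓ]] W.tateModule ℓ)
    (hf : ∀ (σ : Field.absoluteGaloisGroup K) (x : W.tateModule ℓ), f (σ • x) = σ • f x) :
    f ∈ Submodule.span ℤ_[ℓ]
      (Set.range fun φ : Isogeny W W ↦ Literature.NumberTheory.EllipticCurves.TateModule.map ℓ φ.toAddMonoidHom) := by
  obtain ⟨n, hn⟩ := exists_pow_smul_mem_span_tateModule_map_of_equivariant_end ℓ hℓ hquot f hf
  exact mem_span_tateModule_map_of_pow_smul_mem ℓ hℓ h411 hn

/-! ## From `End` to `Hom`: the isogeny theorem as input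

Tate obtains the `Hom(A', A'')` case from the `End` case of `A' × A''` (loc. cit., §1, Lemma 3),
an abelian *surface* when `A', A''` are elliptic curves, which the Weierstrass-curve framework of
the prelude cannot express. For two elliptic curves `E, E'` we instead pass from `End_k(E)` to
`Hom_k(E, E')` through one isogeny `φ₀ : E → E'`, whose existence — as soon as a non-zero
`Γ_k`-map `T_ℓ E → T_ℓ E'` exists — is Tate's Theorem 1(b) (loc. cit., §3), entering as the
hypothesis `hisog` (the tree's named fact
`Literature.AlgebraicGeometry.Motives.isIsogenous_of_finite_iff_exists_tateModule_hom_ne_zero`, the corrected form of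
`isIsogenous_iff_exists_tateModule_hom_ne_zero_of_finite`): a `Γ_k`-equivariant
quasi-inverse `v` of `T_ℓ φ₀` (`T_ℓ φ₀ ∘ v = d`, `v ∘ T_ℓ φ₀ = d`, `d ≠ 0`) turns `f : T_ℓ E → T_ℓ E'`
into the `Γ_k`-endomorphism `v ∘ f` of `T_ℓ E`, and `d • f = T_ℓ φ₀ ∘ (v ∘ f)`. -/

variable {W' : WeierstrassCurve K}

/-- **A `Γ_K`-equivariant quasi-inverse of `T_ℓ φ₀`.** For an isogeny `φ₀ : E → E'` of elliptic
curves over `K` and `ℓ ≠ char K` there are `d ≠ 0` in `ℤ_ℓ` and a `ℤ_ℓ`-linear, `Γ_K`-equivariant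
`v : T_ℓ E' → T_ℓ E` with `T_ℓ φ₀ ∘ v = d` and `v ∘ T_ℓ φ₀ = d` (the adjugate of the injective map
`T_ℓ φ₀` between free modules of rank `2`, `Literature.AlgebraicGeometry.Motives.FinTwo.exists_comp_eq_smul_id_of_injective`).
[folklore] -/
theorem exists_equivariant_quasiInverse [W.IsElliptic] [W'.IsElliptic] (hℓ : (ℓ : K) ≠ 0)
    (φ₀ : Isogeny W W') :
    ∃ (d : ℤ_[ℓ]) (v : W'.tateModule ℓ →ₗ[ℤ_[ℓ]] W.tateModule ℓ), d ≠ 0 ∧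
      Literature.NumberTheory.EllipticCurves.TateModule.map ℓ φ₀.toAddMonoidHom ∘ₗ v = d • LinearMap.id ∧
      v ∘ₗ Literature.NumberTheory.EllipticCurves.TateModule.map ℓ φ₀.toAddMonoidHom = d • LinearMap.id ∧
      ∀ (σ : Field.absoluteGaloisGroup K) (y : W'.tateModule ℓ), v (σ • y) = σ • v y := by
  obtain ⟨e⟩ := nonempty_tateModule_linearEquiv W ℓ hℓ
  obtain ⟨e'⟩ := nonempty_tateModule_linearEquiv W' ℓ hℓ
  set g₀ := Literature.NumberTheory.EllipticCurves.TateModule.map ℓ φ₀.toAddMonoidHom with hg₀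
  -- transport `g₀` to an endomorphism of `ℤ_ℓ²`
  set g₀' : Module.End ℤ_[ℓ] (Fin 2 → ℤ_[ℓ]) :=
    (e' : W'.tateModule ℓ →ₗ[ℤ_[ℓ]] (Fin 2 → ℤ_[ℓ])).comp
      (g₀.comp (e.symm : (Fin 2 → ℤ_[ℓ]) →ₗ[ℤ_[ℓ]] W.tateModule ℓ)) with hg₀'
  have hg₀'_apply : ∀ x, g₀' x = e' (g₀ (e.symm x)) := fun x ↦ rfl
  have hinj : Function.Injective g₀' := fun x y h ↦ by
    rw [hg₀'_apply, hg₀'_apply] at h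
    exact e.symm.injective (tateModule_map_injective ℓ φ₀ (e'.injective h))
  obtain ⟨d, hd, v', hgv', hv'g⟩ := FinTwo.exists_comp_eq_smul_id_of_injective g₀' hinj
  set v : W'.tateModule ℓ →ₗ[ℤ_[ℓ]] W.tateModule ℓ :=
    (e.symm : (Fin 2 → ℤ_[ℓ]) →ₗ[ℤ_[ℓ]] W.tateModule ℓ).comp
      (v'.comp (e' : W'.tateModule ℓ →ₗ[ℤ_[ℓ]] (Fin 2 → ℤ_[ℓ]))) with hv
  have hv_apply : ∀ y, v y = e.symm (v' (e' y)) := fun y ↦ rfl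
  have hgv : ∀ y, g₀ (v y) = d • y := fun y ↦ by
    apply e'.injective
    rw [hv_apply, ← hg₀'_apply, ← Module.End.mul_apply, hgv', LinearMap.smul_apply,
      Module.End.one_apply, map_smul]
  have hvg : ∀ x, v (g₀ x) = d • x := fun x ↦ by
    rw [hv_apply]
    have h1 : e' (g₀ x) = g₀' (e x) := by rw [hg₀'_apply, LinearEquiv.symm_apply_apply]
    rw [h1, ← Module.End.mul_apply, hv'g, LinearMap.smul_apply, Module.End.one_apply, map_smul,
      LinearEquiv.symm_apply_apply]
  refine ⟨d, v, hd, LinearMap.ext fun y ↦ hgv y, LinearMap.ext fun x ↦ hvg x, fun σ y ↦ ?_⟩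
  -- equivariance: `g₀ (v (σ y)) = d σ y = σ (d y) = σ g₀ (v y) = g₀ (σ v y)`
  apply tateModule_map_injective ℓ φ₀
  change g₀ (v (σ • y)) = g₀ (σ • v y)
  rw [hgv, hg₀, tateModule_map_smul, ← hg₀, hgv]
  exact (smul_comm σ d y).symm

/-- **Tate's theorem for `Hom_k(E, E')` of two isogenous curves, rational form**, from the `End`
case. Let `E, E'` be elliptic curves over a finite field `k`, `ℓ` a prime with `ℓ ≠ 0` in `k`,
`φ₀ : E → E'` an isogeny over `k`, and assume quotient isogenies of `E` over `k` exist (`hquot`,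
Silverman, *AEC*, III.4.12–4.13, III.6.1–6.2). Then every `ℤ_ℓ`-linear `Γ_k`-equivariant
`f : T_ℓ E → T_ℓ E'` has a multiple `ℓ ^ n • f` in the `ℤ_ℓ`-span of the `T_ℓ φ`, `φ : E → E'` an
isogeny over `k` (`d • f = T_ℓ φ₀ ∘ (v ∘ f)` for the equivariant quasi-inverse `v` of `T_ℓ φ₀`).
Tate, Invent. Math. 2 (1966), Main Theorem; Silverman, *AEC*, III.7.7(a).
[cite: Tate1966Endomorphisms, Main Theorem] -/
theorem exists_pow_smul_mem_span_tateModule_map_of_equivariant_of_isogeny [Finite K]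
    [W.IsElliptic] [W'.IsElliptic] (hℓ : (ℓ : K) ≠ 0)
    (hquot : ∀ S : AddSubgroup W.geomPoints, (S : Set W.geomPoints).Finite →
      (∀ (σ : Field.absoluteGaloisGroup K) (P : W.geomPoints), P ∈ S → σ • P ∈ S) →
      ∃ (W'' : WeierstrassCurve K) (_ : W''.IsElliptic) (g : Isogeny W W'') (f : Isogeny W'' W),
        g.toAddMonoidHom.ker = S ∧ (∀ P, f (g P) = Nat.card S • P) ∧
          ∀ Q, g (f Q) = Nat.card S • Q)
    (φ₀ : Isogeny W W') (f : W.tateModule ℓ →ₗ[ℤ_[ℓ]] W'.tateModule ℓ)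
    (hf : ∀ (σ : Field.absoluteGaloisGroup K) (x : W.tateModule ℓ), f (σ • x) = σ • f x) :
    ∃ n : ℕ, (ℓ : ℤ_[ℓ]) ^ n • f ∈ Submodule.span ℤ_[ℓ]
      (Set.range fun φ : Isogeny W W' ↦ Literature.NumberTheory.EllipticCurves.TateModule.map ℓ φ.toAddMonoidHom) := by
  -- the equivariant quasi-inverse of `T_ℓ φ₀`
  obtain ⟨d, v, hd, hgv, -, hveq⟩ := exists_equivariant_quasiInverse ℓ hℓ φ₀
  -- `v ∘ f ∈ End_Γ(T_ℓ E)`: the `End` case applies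
  have hvf : ∀ (σ : Field.absoluteGaloisGroup K) (x : W.tateModule ℓ),
      (v ∘ₗ f) (σ • x) = σ • (v ∘ₗ f) x := fun σ x ↦ by
    rw [LinearMap.comp_apply, LinearMap.comp_apply, hf, hveq]
  obtain ⟨n, hn⟩ :=
    exists_pow_smul_mem_span_tateModule_map_of_equivariant_end ℓ hℓ hquot (v ∘ₗ f) hvf
  -- push forward along `T_ℓ φ₀ ∘ -`
  set L : (W.tateModule ℓ →ₗ[ℤ_[ℓ]] W.tateModule ℓ) →ₗ[ℤ_[ℓ]]
      W.tateModule ℓ →ₗ[ℤ_[ℓ]] W'.tateModule ℓ :=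
    LinearMap.llcomp ℤ_[ℓ] _ _ _ (Literature.NumberTheory.EllipticCurves.TateModule.map ℓ φ₀.toAddMonoidHom) with hL
  have hLspan : (Submodule.span ℤ_[ℓ]
      (Set.range fun ψ : Isogeny W W ↦ Literature.NumberTheory.EllipticCurves.TateModule.map ℓ ψ.toAddMonoidHom)).map L ≤
      Submodule.span ℤ_[ℓ] (Set.range fun χ : Isogeny W W' ↦ Literature.NumberTheory.EllipticCurves.TateModule.map ℓ χ.toAddMonoidHom) := by
    rw [Submodule.map_span, Submodule.span_le]
    rintro _ ⟨_, ⟨ψ, rfl⟩, rfl⟩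
    refine Submodule.subset_span ⟨φ₀.comp ψ, ?_⟩
    rw [hL, LinearMap.llcomp_apply']
    exact Literature.NumberTheory.EllipticCurves.TateModule.map_comp _ _
  have h1 := hLspan (Submodule.mem_map_of_mem hn)
  have h2 : L ((ℓ : ℤ_[ℓ]) ^ n • (v ∘ₗ f)) = ((ℓ : ℤ_[ℓ]) ^ n * d) • f := by
    rw [map_smul, hL, LinearMap.llcomp_apply', ← LinearMap.comp_assoc, hgv, LinearMap.smul_comp,
      LinearMap.id_comp, smul_smul]
  rw [h2] at h1
  obtain ⟨m, u, hu⟩ : ∃ (m : ℕ) (u : ℤ_[ℓ]ˣ), d = u * (ℓ : ℤ_[ℓ]) ^ m :=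
    ⟨_, _, PadicInt.unitCoeff_spec hd⟩
  refine ⟨n + m, ?_⟩
  have h3 : (ℓ : ℤ_[ℓ]) ^ (n + m) • f =
      ((u⁻¹ : ℤ_[ℓ]ˣ) : ℤ_[ℓ]) • (((ℓ : ℤ_[ℓ]) ^ n * d) • f) := by
    rw [hu, smul_smul, pow_add, mul_left_comm ((ℓ : ℤ_[ℓ]) ^ n) (u : ℤ_[ℓ]), ← mul_assoc,
      ← mul_assoc, Units.inv_mul, one_mul]
  rw [h3]
  exact Submodule.smul_mem _ _ h1

/-- **Tate's theorem for `Hom_k(E, E')`, rational form**, from the `End` case and the isogeny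
theorem. Let `E, E'` be elliptic curves over a finite field `k`, `ℓ` a prime with `ℓ ≠ 0` in `k`;
assume quotient isogenies of `E` over `k` exist (`hquot`, Silverman, *AEC*, III.4.12–4.13,
III.6.1–6.2) and Tate's isogeny theorem for `(E, E')` at `ℓ` (`hisog`, the named fact
`isIsogenous_of_finite_iff_exists_tateModule_hom_ne_zero W W' ℓ`, Tate, loc. cit., Theorem 1(b)),
which is used only to produce one isogeny `E → E'` when `f ≠ 0`. Then every `ℤ_ℓ`-linear
`Γ_k`-equivariant `f : T_ℓ E → T_ℓ E'` has a multiple `ℓ ^ n • f` in the `ℤ_ℓ`-span of the `T_ℓ φ`,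
`φ : E → E'` an isogeny over `k`. Tate, Invent. Math. 2 (1966), Main Theorem; Silverman, *AEC*,
III.7.7(a). [cite: Tate1966Endomorphisms, Main Theorem] -/
theorem exists_pow_smul_mem_span_tateModule_map_of_equivariant [Finite K] [W.IsElliptic]
    [W'.IsElliptic] (hℓ : (ℓ : K) ≠ 0)
    (hquot : ∀ S : AddSubgroup W.geomPoints, (S : Set W.geomPoints).Finite →
      (∀ (σ : Field.absoluteGaloisGroup K) (P : W.geomPoints), P ∈ S → σ • P ∈ S) →
      ∃ (W'' : WeierstrassCurve K) (_ : W''.IsElliptic) (g : Isogeny W W'') (f : Isogeny W'' W),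
        g.toAddMonoidHom.ker = S ∧ (∀ P, f (g P) = Nat.card S • P) ∧
          ∀ Q, g (f Q) = Nat.card S • Q)
    (hisog : isIsogenous_of_finite_iff_exists_tateModule_hom_ne_zero W W' ℓ)
    (f : W.tateModule ℓ →ₗ[ℤ_[ℓ]] W'.tateModule ℓ)
    (hf : ∀ (σ : Field.absoluteGaloisGroup K) (x : W.tateModule ℓ), f (σ • x) = σ • f x) :
    ∃ n : ℕ, (ℓ : ℤ_[ℓ]) ^ n • f ∈ Submodule.span ℤ_[ℓ]
      (Set.range fun φ : Isogeny W W' ↦ Literature.NumberTheory.EllipticCurves.TateModule.map ℓ φ.toAddMonoidHom) := by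
  by_cases hf0 : f = 0
  · exact ⟨0, by rw [hf0, smul_zero]; exact Submodule.zero_mem _⟩
  obtain ⟨φ₀⟩ := (hisog hℓ).mpr ⟨f, hf0, hf⟩
  exact exists_pow_smul_mem_span_tateModule_map_of_equivariant_of_isogeny ℓ hℓ hquot φ₀ f hf

/-- **Tate's theorem for two isogenous elliptic curves over a finite field, from quotient isogenies
and Cor. III.4.11**: if `E, E'` are isogenous over `k`, the named fact
`mem_span_range_tateModule_map_of_equivariant_of_finite W W' ℓ` follows from quotient isogenies of
`E` over `k` (`hquot`) and Cor. III.4.11 over `k` for `(E, E')` (`h411`) — no isogeny theorem is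
needed. [cite: Tate1966Endomorphisms, Main Theorem] -/
theorem mem_span_range_tateModule_map_of_equivariant_of_finite_of_quot_of_isIsogenous
    (hquot : ∀ S : AddSubgroup W.geomPoints, (S : Set W.geomPoints).Finite →
      (∀ (σ : Field.absoluteGaloisGroup K) (P : W.geomPoints), P ∈ S → σ • P ∈ S) →
      ∃ (W'' : WeierstrassCurve K) (_ : W''.IsElliptic) (g : Isogeny W W'') (f : Isogeny W'' W),
        g.toAddMonoidHom.ker = S ∧ (∀ P, f (g P) = Nat.card S • P) ∧
          ∀ Q, g (f Q) = Nat.card S • Q)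
    (h411 : Isogeny.exists_eq_comp_nsmul_of_geomTorsion_le_ker W W') (hiso : W.IsIsogenous W') :
    mem_span_range_tateModule_map_of_equivariant_of_finite W W' ℓ := by
  intro _ _ _ hℓ f hf
  obtain ⟨φ₀⟩ := hiso
  obtain ⟨n, hn⟩ :=
    exists_pow_smul_mem_span_tateModule_map_of_equivariant_of_isogeny ℓ hℓ hquot φ₀ f hf
  exact mem_span_tateModule_map_of_pow_smul_mem ℓ hℓ h411 hn

/-- **Tate's theorem for elliptic curves over a finite field, from its geometric inputs.** The
named fact `mem_span_range_tateModule_map_of_equivariant_of_finite W W' ℓ` (Tate, Invent. Math. 2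
(1966), Main Theorem: `Hom_k(E, E') ⊗ ℤ_ℓ → Hom_Γ(T_ℓ E, T_ℓ E')` is onto) follows from:
quotient isogenies of `E` over `k` (`hquot`: Silverman, *AEC*, Prop. III.4.12, Rem. III.4.13.2,
Thm. III.6.1–6.2), Cor. III.4.11 over `k` for `(E, E')` (`h411`, the named fact
`Isogeny.exists_eq_comp_nsmul_of_geomTorsion_le_ker W W'`), and — only to produce one isogeny
`E → E'` when `E ≠ E'` — Tate's Theorem 1(b) (`hisog`, the named fact
`isIsogenous_of_finite_iff_exists_tateModule_hom_ne_zero W W' ℓ`; for `E = E'` see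
`mem_span_range_tateModule_map_of_equivariant_of_finite_end_of_quot`, which does not need it).
Everything else — Tate's Lemma 1, Propositions 1 and 2, Lemma 4 for `g = 1` — is proved in the
tree (module docstring). [cite: Tate1966Endomorphisms, Main Theorem] -/
theorem mem_span_range_tateModule_map_of_equivariant_of_finite_of_quot
    (hquot : ∀ S : AddSubgroup W.geomPoints, (S : Set W.geomPoints).Finite →
      (∀ (σ : Field.absoluteGaloisGroup K) (P : W.geomPoints), P ∈ S → σ • P ∈ S) →
      ∃ (W'' : WeierstrassCurve K) (_ : W''.IsElliptic) (g : Isogeny W W'') (f : Isogeny W'' W),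
        g.toAddMonoidHom.ker = S ∧ (∀ P, f (g P) = Nat.card S • P) ∧
          ∀ Q, g (f Q) = Nat.card S • Q)
    (h411 : Isogeny.exists_eq_comp_nsmul_of_geomTorsion_le_ker W W')
    (hisog : isIsogenous_of_finite_iff_exists_tateModule_hom_ne_zero W W' ℓ) :
    mem_span_range_tateModule_map_of_equivariant_of_finite W W' ℓ := by
  intro _ _ _ hℓ f hf
  obtain ⟨n, hn⟩ := exists_pow_smul_mem_span_tateModule_map_of_equivariant ℓ hℓ hquot hisog f hf
  exact mem_span_tateModule_map_of_pow_smul_mem ℓ hℓ h411 hn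

/-- **Tate's theorem for `End_k(E)` from its geometric inputs** (the case `E = E'` of the named
fact, without the isogeny theorem): `mem_span_range_tateModule_map_of_equivariant_of_finite W W ℓ`
follows from quotient isogenies of `E` over `k` (`hquot`: Silverman, *AEC*, III.4.12–4.13,
III.6.1–6.2) and Cor. III.4.11 over `k` (`h411`). [cite: Tate1966Endomorphisms, Main Theorem] -/
theorem mem_span_range_tateModule_map_of_equivariant_of_finite_end_of_quot
    (hquot : ∀ S : AddSubgroup W.geomPoints, (S : Set W.geomPoints).Finite →
      (∀ (σ : Field.absoluteGaloisGroup K) (P : W.geomPoints), P ∈ S → σ • P ∈ S) →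
      ∃ (W'' : WeierstrassCurve K) (_ : W''.IsElliptic) (g : Isogeny W W'') (f : Isogeny W'' W),
        g.toAddMonoidHom.ker = S ∧ (∀ P, f (g P) = Nat.card S • P) ∧
          ∀ Q, g (f Q) = Nat.card S • Q)
    (h411 : Isogeny.exists_eq_comp_nsmul_of_geomTorsion_le_ker W W) :
    mem_span_range_tateModule_map_of_equivariant_of_finite W W ℓ := by
  intro _ _ _ hℓ f hf
  exact mem_span_tateModule_map_of_equivariant_end ℓ hℓ hquot h411 f hf

/-- **Tate's theorem, `End` form, from its geometric inputs**: the named fact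
`mem_span_range_tateEndRingHom_iff_of_finite W ℓ` of `FaltingsEC` — for `E` elliptic over a finite
field `k` and `ℓ ≠ char k`, a `ℤ_ℓ`-linear endomorphism of `T_ℓ E` lies in `ℤ_ℓ · End_k(E)` (the
span of the image of `tateEndRingHom W ℓ`) iff it commutes with `Γ_k` — follows from quotient
isogenies of `E` over `k` (`hquot`) and Cor. III.4.11 over `k` (`h411`): the reverse implication is
`mem_span_tateModule_map_of_equivariant_end` (an isogeny `E → E` over `k` is an element of
`End_k(E)`, `Isogeny.toAddMonoidHom_mem_endRing`), the forward one the elementary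
`smul_of_mem_span_range_tateEndRingHom`. Tate, Invent. Math. 2 (1966), Main Theorem; Silverman,
*AEC*, III.7.7(a). [cite: Tate1966Endomorphisms, Main Theorem] -/
theorem mem_span_range_tateEndRingHom_iff_of_finite_of_quot
    (hquot : ∀ S : AddSubgroup W.geomPoints, (S : Set W.geomPoints).Finite →
      (∀ (σ : Field.absoluteGaloisGroup K) (P : W.geomPoints), P ∈ S → σ • P ∈ S) →
      ∃ (W'' : WeierstrassCurve K) (_ : W''.IsElliptic) (g : Isogeny W W'') (f : Isogeny W'' W),
        g.toAddMonoidHom.ker = S ∧ (∀ P, f (g P) = Nat.card S • P) ∧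
          ∀ Q, g (f Q) = Nat.card S • Q)
    (h411 : Isogeny.exists_eq_comp_nsmul_of_geomTorsion_le_ker W W) :
    mem_span_range_tateEndRingHom_iff_of_finite W ℓ := by
  intro _ _ hℓ g
  refine ⟨fun hg σ x ↦ smul_of_mem_span_range_tateEndRingHom W ℓ hg σ x, fun hg ↦ ?_⟩
  refine Submodule.span_mono ?_ (mem_span_tateModule_map_of_equivariant_end ℓ hℓ hquot h411 g hg)
  rintro _ ⟨φ, rfl⟩
  exact ⟨⟨φ.toAddMonoidHom, φ.toAddMonoidHom_mem_endRing⟩, rfl⟩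

/-! ## Non-scalar Frobenius: the `End` case without quotient isogenies (appended)

In the proof of `exists_pow_smul_mem_span_tateModule_map_of_equivariant_end` the geometric input
`hquot` (quotient isogenies over `k`, feeding Tate's Proposition 1) is used only when the
`q`-power Frobenius `σ_q ∈ Γ_k` acts on `T_ℓ E` as a scalar. When it does not, the commutant of
`T_ℓ(π_E) = ρ_ℓ(σ_q)` in `End(ℤ_ℓ²)` is met by `ℤ_ℓ · 1 + ℤ_ℓ · T_ℓ(π_E)` up to a non-zero
determinant factor (`Literature.AlgebraicGeometry.Motives.FinTwo.exists_smul_eq_of_commute`), and `1 = T_ℓ(id_E)`,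
`T_ℓ(π_E)` (`WeierstrassCurve.tateModule_map_frobeniusIsogeny`) lie in the image of `End_k(E)`.
The theorems below record this case free of `hquot`; combined with Cor. III.4.11 over `k`
(`h411`, which the tree proves: `IsogenyHomNsmulProofs`) they give Tate's theorem for `End_k(E)`,
and for `Hom_k(E, E')` of isogenous curves, whenever `ρ_ℓ(σ_q)` is not a scalar on `T_ℓ E` (this
holds, for instance, for every ordinary `E` — a remark not formalised here). The element `σ_q` of
`Γ_k = Gal(k̄/k)` is determined by `σ_q x = x ^ q` on `k̄`, so the hypothesis does not depend on a
choice. -/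

/-- **Tate's theorem for `End_k(E)`, rational form, when Frobenius is not a scalar on `T_ℓ E`**
(no quotient isogenies needed): for `E` elliptic over a finite field `k` with `q` elements,
`ℓ ≠ char k`, and `σ_q ∈ Γ_k` the `q`-power Frobenius, if `ρ_ℓ(σ_q) ∈ End(T_ℓ E)` is not of the
form `c • 1`, then every `Γ_k`-equivariant `ℤ_ℓ`-linear `f : T_ℓ E → T_ℓ E` has a multiple
`ℓ ^ n • f` in the `ℤ_ℓ`-span of the `T_ℓ φ`, `φ ∈ End_k(E)` — indeed `d • f = α • 1 + β • T_ℓ(π_E)`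
with `d ≠ 0` (the non-scalar branch of the proof of
`exists_pow_smul_mem_span_tateModule_map_of_equivariant_end`). Tate, Invent. Math. 2 (1966),
Main Theorem (special case). [cite: Tate1966Endomorphisms, Main Theorem] -/
theorem exists_pow_smul_mem_span_tateModule_map_of_equivariant_end_of_ne_smul [Finite K]
    [W.IsElliptic] (hℓ : (ℓ : K) ≠ 0) {σ : Field.absoluteGaloisGroup K}
    (hσ : ∀ x : AlgebraicClosure K, σ • x = x ^ Nat.card K)
    (hns : ∀ c : ℤ_[ℓ], W.galoisRepTate ℓ σ ≠ c • 1)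
    (f : W.tateModule ℓ →ₗ[ℤ_[ℓ]] W.tateModule ℓ)
    (hf : ∀ (σ : Field.absoluteGaloisGroup K) (x : W.tateModule ℓ), f (σ • x) = σ • f x) :
    ∃ n : ℕ, (ℓ : ℤ_[ℓ]) ^ n • f ∈ Submodule.span ℤ_[ℓ]
      (Set.range fun φ : Isogeny W W ↦ Literature.NumberTheory.EllipticCurves.TateModule.map ℓ φ.toAddMonoidHom) := by
  set S := Submodule.span ℤ_[ℓ]
    (Set.range fun φ : Isogeny W W ↦ Literature.NumberTheory.EllipticCurves.TateModule.map ℓ φ.toAddMonoidHom) with hS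
  -- it suffices to find `d ≠ 0` with `d • f ∈ S`
  suffices key : ∃ d : ℤ_[ℓ], d ≠ 0 ∧ d • f ∈ S by
    obtain ⟨d, hd, hdf⟩ := key
    obtain ⟨n, u, rfl⟩ : ∃ (n : ℕ) (u : ℤ_[ℓ]ˣ), d = u * (ℓ : ℤ_[ℓ]) ^ n :=
      ⟨_, _, PadicInt.unitCoeff_spec hd⟩
    refine ⟨n, ?_⟩
    have hu : (ℓ : ℤ_[ℓ]) ^ n • f = ((u⁻¹ : ℤ_[ℓ]ˣ) : ℤ_[ℓ]) • (((u : ℤ_[ℓ]) * (ℓ : ℤ_[ℓ]) ^ n) • f) := by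
      rw [smul_smul, ← mul_assoc, Units.inv_mul, one_mul]
    rw [hu]
    exact S.smul_mem _ hdf
  obtain ⟨e⟩ := nonempty_tateModule_linearEquiv W ℓ hℓ
  -- `π = ρ_ℓ(σ_q) = T_ℓ(π_E)`, and `f π = π f`
  set π : Module.End ℤ_[ℓ] (W.tateModule ℓ) := W.galoisRepTate ℓ σ with hπdef
  have hπS : π ∈ S :=
    Submodule.subset_span ⟨W.frobeniusIsogeny hσ, W.tateModule_map_frobeniusIsogeny hσ ℓ⟩
  have h1S : (1 : Module.End ℤ_[ℓ] (W.tateModule ℓ)) ∈ S := by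
    refine Submodule.subset_span ⟨Isogeny.id W, ?_⟩
    exact Literature.NumberTheory.EllipticCurves.TateModule.map_id
  have hfπ : f * π = π * f := LinearMap.ext fun x ↦ by
    rw [Module.End.mul_apply, Module.End.mul_apply, hπdef, galoisRepTate_apply_apply,
      galoisRepTate_apply_apply, hf]
  -- `π` is not a scalar, neither is its conjugate on `ℤ_ℓ²`
  have hscalar : ∀ c : ℤ_[ℓ], e.conj π ≠ c • 1 := by
    intro c hc
    apply hns c
    have := congrArg e.symm.conj hc
    rwa [LinearEquiv.conj_symm_conj, map_smul, Module.End.one_eq_id, LinearEquiv.conj_id] at this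
  -- the commutant of a non-scalar `2 × 2` matrix
  obtain ⟨z, hD⟩ := FinTwo.exists_det_apply_ne_zero hscalar
  have hcomm : e.conj f * e.conj π = e.conj π * e.conj f := by
    rw [Module.End.mul_eq_comp, Module.End.mul_eq_comp, ← LinearEquiv.conj_comp,
      ← LinearEquiv.conj_comp, ← Module.End.mul_eq_comp, ← Module.End.mul_eq_comp, hfπ]
  obtain ⟨α, β, hαβ⟩ := FinTwo.exists_smul_eq_of_commute z hD hcomm
  refine ⟨_, hD, ?_⟩
  have : (z 0 * (e.conj π) z 1 - z 1 * (e.conj π) z 0) • f = α • 1 + β • π := by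
    apply e.conj.injective
    rw [map_smul, hαβ, map_add, map_smul, map_smul]
    congr 2
    exact (LinearEquiv.conj_id e).symm
  rw [this]
  exact S.add_mem (S.smul_mem _ h1S) (S.smul_mem _ hπS)

/-- **Tate's theorem for `End_k(E)`, integral form, when Frobenius is not a scalar on `T_ℓ E`**:
from the rational form and Tate's Lemma 1 (`mem_span_tateModule_map_of_pow_smul_mem`, which needs
Cor. III.4.11 over `k`, `h411`). [cite: Tate1966Endomorphisms, Main Theorem] -/
theorem mem_span_tateModule_map_of_equivariant_end_of_ne_smul [Finite K] [W.IsElliptic]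
    (hℓ : (ℓ : K) ≠ 0) {σ : Field.absoluteGaloisGroup K}
    (hσ : ∀ x : AlgebraicClosure K, σ • x = x ^ Nat.card K)
    (hns : ∀ c : ℤ_[ℓ], W.galoisRepTate ℓ σ ≠ c • 1)
    (h411 : Isogeny.exists_eq_comp_nsmul_of_geomTorsion_le_ker W W)
    (f : W.tateModule ℓ →ₗ[ℤ_[ℓ]] W.tateModule ℓ)
    (hf : ∀ (σ : Field.absoluteGaloisGroup K) (x : W.tateModule ℓ), f (σ • x) = σ • f x) :
    f ∈ Submodule.span ℤ_[ℓ]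
      (Set.range fun φ : Isogeny W W ↦ Literature.NumberTheory.EllipticCurves.TateModule.map ℓ φ.toAddMonoidHom) := by
  obtain ⟨n, hn⟩ :=
    exists_pow_smul_mem_span_tateModule_map_of_equivariant_end_of_ne_smul ℓ hℓ hσ hns f hf
  exact mem_span_tateModule_map_of_pow_smul_mem ℓ hℓ h411 hn

/-- **Tate's theorem for `Hom_k(E, E')` of isogenous curves, rational form, when Frobenius is not a
scalar on `T_ℓ E`**: as `exists_pow_smul_mem_span_tateModule_map_of_equivariant_of_isogeny`, with
the `End` case of `E` supplied by `…_end_of_ne_smul` instead of quotient isogenies.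
[cite: Tate1966Endomorphisms, Main Theorem] -/
theorem exists_pow_smul_mem_span_tateModule_map_of_equivariant_of_isogeny_of_ne_smul [Finite K]
    [W.IsElliptic] [W'.IsElliptic] (hℓ : (ℓ : K) ≠ 0) {σ : Field.absoluteGaloisGroup K}
    (hσ : ∀ x : AlgebraicClosure K, σ • x = x ^ Nat.card K)
    (hns : ∀ c : ℤ_[ℓ], W.galoisRepTate ℓ σ ≠ c • 1)
    (φ₀ : Isogeny W W') (f : W.tateModule ℓ →ₗ[ℤ_[ℓ]] W'.tateModule ℓ)
    (hf : ∀ (σ : Field.absoluteGaloisGroup K) (x : W.tateModule ℓ), f (σ • x) = σ • f x) :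
    ∃ n : ℕ, (ℓ : ℤ_[ℓ]) ^ n • f ∈ Submodule.span ℤ_[ℓ]
      (Set.range fun φ : Isogeny W W' ↦ Literature.NumberTheory.EllipticCurves.TateModule.map ℓ φ.toAddMonoidHom) := by
  -- the equivariant quasi-inverse of `T_ℓ φ₀`
  obtain ⟨d, v, hd, hgv, -, hveq⟩ := exists_equivariant_quasiInverse ℓ hℓ φ₀
  have hvf : ∀ (σ : Field.absoluteGaloisGroup K) (x : W.tateModule ℓ),
      (v ∘ₗ f) (σ • x) = σ • (v ∘ₗ f) x := fun σ x ↦ by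
    rw [LinearMap.comp_apply, LinearMap.comp_apply, hf, hveq]
  obtain ⟨n, hn⟩ :=
    exists_pow_smul_mem_span_tateModule_map_of_equivariant_end_of_ne_smul ℓ hℓ hσ hns (v ∘ₗ f) hvf
  -- push forward along `T_ℓ φ₀ ∘ -`
  set L : (W.tateModule ℓ →ₗ[ℤ_[ℓ]] W.tateModule ℓ) →ₗ[ℤ_[ℓ]]
      W.tateModule ℓ →ₗ[ℤ_[ℓ]] W'.tateModule ℓ :=
    LinearMap.llcomp ℤ_[ℓ] _ _ _ (Literature.NumberTheory.EllipticCurves.TateModule.map ℓ φ₀.toAddMonoidHom) with hL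
  have hLspan : (Submodule.span ℤ_[ℓ]
      (Set.range fun ψ : Isogeny W W ↦ Literature.NumberTheory.EllipticCurves.TateModule.map ℓ ψ.toAddMonoidHom)).map L ≤
      Submodule.span ℤ_[ℓ] (Set.range fun χ : Isogeny W W' ↦ Literature.NumberTheory.EllipticCurves.TateModule.map ℓ χ.toAddMonoidHom) := by
    rw [Submodule.map_span, Submodule.span_le]
    rintro _ ⟨_, ⟨ψ, rfl⟩, rfl⟩
    refine Submodule.subset_span ⟨φ₀.comp ψ, ?_⟩
    rw [hL, LinearMap.llcomp_apply']
    exact Literature.NumberTheory.EllipticCurves.TateModule.map_comp _ _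
  have h1 := hLspan (Submodule.mem_map_of_mem hn)
  have h2 : L ((ℓ : ℤ_[ℓ]) ^ n • (v ∘ₗ f)) = ((ℓ : ℤ_[ℓ]) ^ n * d) • f := by
    rw [map_smul, hL, LinearMap.llcomp_apply', ← LinearMap.comp_assoc, hgv, LinearMap.smul_comp,
      LinearMap.id_comp, smul_smul]
  rw [h2] at h1
  obtain ⟨m, u, hu⟩ : ∃ (m : ℕ) (u : ℤ_[ℓ]ˣ), d = u * (ℓ : ℤ_[ℓ]) ^ m :=
    ⟨_, _, PadicInt.unitCoeff_spec hd⟩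
  refine ⟨n + m, ?_⟩
  have h3 : (ℓ : ℤ_[ℓ]) ^ (n + m) • f =
      ((u⁻¹ : ℤ_[ℓ]ˣ) : ℤ_[ℓ]) • (((ℓ : ℤ_[ℓ]) ^ n * d) • f) := by
    rw [hu, smul_smul, pow_add, mul_left_comm ((ℓ : ℤ_[ℓ]) ^ n) (u : ℤ_[ℓ]), ← mul_assoc,
      ← mul_assoc, Units.inv_mul, one_mul]
  rw [h3]
  exact Submodule.smul_mem _ _ h1

/-- **Tate's theorem for two isogenous elliptic curves over a finite field, when Frobenius is not a
scalar on `T_ℓ E`, from Cor. III.4.11 alone**: the named fact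
`mem_span_range_tateModule_map_of_equivariant_of_finite W W' ℓ` follows from `h411` (Cor. III.4.11
over `k` for `(E, E')`) for `E ~_k E'` with `ρ_ℓ(σ_q)` non-scalar on `T_ℓ E`; no quotient
isogenies and no isogeny theorem are needed. [cite: Tate1966Endomorphisms, Main Theorem] -/
theorem mem_span_range_tateModule_map_of_equivariant_of_finite_of_ne_smul_of_isIsogenous
    {σ : Field.absoluteGaloisGroup K} (hσ : ∀ x : AlgebraicClosure K, σ • x = x ^ Nat.card K)
    (hns : ∀ c : ℤ_[ℓ], W.galoisRepTate ℓ σ ≠ c • 1)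
    (h411 : Isogeny.exists_eq_comp_nsmul_of_geomTorsion_le_ker W W') (hiso : W.IsIsogenous W') :
    mem_span_range_tateModule_map_of_equivariant_of_finite W W' ℓ := by
  intro _ _ _ hℓ f hf
  obtain ⟨φ₀⟩ := hiso
  obtain ⟨n, hn⟩ := exists_pow_smul_mem_span_tateModule_map_of_equivariant_of_isogeny_of_ne_smul
    ℓ hℓ hσ hns φ₀ f hf
  exact mem_span_tateModule_map_of_pow_smul_mem ℓ hℓ h411 hn

/-- **Tate's theorem for `End_k(E)` when Frobenius is not a scalar on `T_ℓ E`, from Cor. III.4.11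
alone**: `mem_span_range_tateModule_map_of_equivariant_of_finite W W ℓ` follows from `h411`
(Cor. III.4.11 over `k`). [cite: Tate1966Endomorphisms, Main Theorem] -/
theorem mem_span_range_tateModule_map_of_equivariant_of_finite_end_of_ne_smul
    {σ : Field.absoluteGaloisGroup K} (hσ : ∀ x : AlgebraicClosure K, σ • x = x ^ Nat.card K)
    (hns : ∀ c : ℤ_[ℓ], W.galoisRepTate ℓ σ ≠ c • 1)
    (h411 : Isogeny.exists_eq_comp_nsmul_of_geomTorsion_le_ker W W) :
    mem_span_range_tateModule_map_of_equivariant_of_finite W W ℓ := by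
  intro _ _ _ hℓ f hf
  exact mem_span_tateModule_map_of_equivariant_end_of_ne_smul ℓ hℓ hσ hns h411 f hf

/-- **Tate's theorem, `End` form, when Frobenius is not a scalar on `T_ℓ E`, from Cor. III.4.11
alone**: the named fact `mem_span_range_tateEndRingHom_iff_of_finite W ℓ` of `FaltingsEC` follows
from `h411`. [cite: Tate1966Endomorphisms, Main Theorem] -/
theorem mem_span_range_tateEndRingHom_iff_of_finite_of_ne_smul
    {σ : Field.absoluteGaloisGroup K} (hσ : ∀ x : AlgebraicClosure K, σ • x = x ^ Nat.card K)
    (hns : ∀ c : ℤ_[ℓ], W.galoisRepTate ℓ σ ≠ c • 1)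
    (h411 : Isogeny.exists_eq_comp_nsmul_of_geomTorsion_le_ker W W) :
    mem_span_range_tateEndRingHom_iff_of_finite W ℓ := by
  intro _ _ hℓ g
  refine ⟨fun hg σ x ↦ smul_of_mem_span_range_tateEndRingHom W ℓ hg σ x, fun hg ↦ ?_⟩
  refine Submodule.span_mono ?_
    (mem_span_tateModule_map_of_equivariant_end_of_ne_smul ℓ hℓ hσ hns h411 g hg)
  rintro _ ⟨φ, rfl⟩
  exact ⟨⟨φ.toAddMonoidHom, φ.toAddMonoidHom_mem_endRing⟩, rfl⟩

end Literature.AlgebraicGeometry.Motives
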